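import Summits.QuantumFields.YangMills.Theorems.BalabanUVNodesN15TwoSpacingGluingCurvedKnitAdjoint
import Summits.QuantumFields.YangMills.Theorems.BalabanUVNodesN15TwoSpacingGluingCurvedKnitSmallFieldPair
import HarnessLib

/-!
# ENTRY 2 OF THE LIVE GLUED PROPAGATOR AT THE COVER IN THE GLOBAL SMALL-FIELD GAUGE, ONE GRID: `cvGlued … 1 e^{ηĀ′} (N_L⊗1) 0 ∘ ∇̂⁻_ν` DECAYS — n15-c∕175 `one_bgrad_cvGlued_spec` with its
# GLOBAL species letters PRODUCED from the C² window of the fine potential alone (conjuncts 1, 2, 7, 9 of dag-n15-w2's fifteen `TwoSidedLetters` of `(A′, Ā′ = gavgM π̂ A′)`)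
# (dag-n15-c g19, n15-c∕176; N15 = NE2, s1 road (c) — FILE 133's currency, the node's)

Cell `pub-ymgap`, seat `pub-ymgap-dag-n15-c` (R134 (a); HUMAN RULING D-0062), generation 19.  `bears_on: R4∕N15 · K3⁸ SpineGivenEndpointR13SepCoPHV (stmt-QuantumFields-27366)`.
Filed `--kind proof --supports stmt-QuantumFields-27366 --as helper` — COUNT-NEUTRAL.  Theorems only; 0 `def`, 0 `sorry`.  Imports BY NAME n15-c∕175 `…TwoSpacingGluingCurvedKnitAdjoint`
(★★★ `one_bgrad_cvGlued_spec`) and FILE 133 `…CurvedKnitSmallFieldPair` (through it FILE 130's `curvCoefC_one` ∕ `curvCoefA_one` ∕ `conj_one_exp_eq_expTrField`, dag-n15-w2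
`twoSidedLetters_curvCoef_one_of_meanGauge`, the King-pairing geometry `bshiftEquiv_comm` ∕ `fibre_conn_kingPrV` ∕ `kingPrV_bshiftEquiv_pow`, `gavgM_conjTranspose_of_skew`).  Nothing in the
tree is modified; nothing restated.

WHAT.  ★★★ `sf_bgrad_cvGlued_spec` — for odd `L ≥ 7`, `a > 0`, `ι`: `∃ δ w₀ R₀ B > 0, ∀ mv kk r (k ≥ 1, L^m ≥ w₀) ν e he, ∀ A′` skew-Hermitian in the C² window at scale `r_A`
(`2(2+d)(5+2d)r_A ≤ 1`, `scale·(1+|J⊕J|) ≤ R₀` — FILE 133's hypotheses VERBATIM): `cvGlued … 1 e^{ηĀ′} (N_L⊗1) 0 ∘ ∇̂⁻_ν ≤ B·e^{−δ|y−y′|_T}` on the coarse unit blocks — entry 2 of [B9]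
(3.42) (adjoint arrangement, the flat quotient; the covariant dressing `∇^{U*}` is the transport of FILE 159) for the live glued propagator of the node's small-field family, ONE GRID.

HONEST FRAMING ∕ LIMITS.  Assembly of n15-c∕175 with dag-n15-w2's letter bundle; MODEL operator (covariant Laplacian (3.50) ⊗ colour + FLAT nonlocal part (1.69)) ∕ MODEL class (global
gauge, C² window) ∕ King's pairing ∕ dag-n15-a's carriers; constants crude; the SHAPE of [B9] Thm 3.1 (3.42) entry 2 on one grid, NOT the printed theorem; nothing of [B5]∕[B6]∕[B9]
asserted.  NE2 for non-abelian `G(U)` NOT proved (C-N15-1); N15 booked «discharged AS CONSUMED at the U-blind v7 pin» (№253) — road (c)'s bookkeeping, NO count; K3⁸ skeleton untouched;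
one finite 𝕋⁴ at fixed ε — NOT infinite volume, NOT OS, NOT a mass gap, NOT Clay.  Restate-immune (no Theses import).
-/

noncomputable section

open scoped BigOperators Matrix Matrix.Norms.Frobenius

namespace Summit.QuantumFields.YangMills.BalabanUVNodes.N15.Gluing

open Literature.MathematicalPhysics.QuantumFieldTheory.Balaban1983to89
open Literature.MathematicalPhysics.QuantumFieldTheory.Balaban1983to89.B11SectG (BlockNorm HasMaj)
open Literature.MathematicalPhysics.QuantumFieldTheory.Balaban1983to89.B6Prop26Gluing (mulOp)
open Literature.MathematicalPhysics.QuantumFieldTheory.Balaban1983to89.B6UnitTorusCarrier (unitTorusGeo unitTorusGeo_dist_nonneg)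
open Literature.MathematicalPhysics.QuantumFieldTheory.King1986.Torus (blockOf)
open Literature.Barriers.QuantumFields (traceForm)
open Literature.MathematicalPhysics.QuantumFieldTheory.Balaban1983to89.Beta.AveragingCorrectionJets (adCLM)
open Summit.QuantumFields.YangMills.BalabanUVNodes.N15.BackgroundLayer (bgrad covLapM tCoefA tCoefC gavgM fgradMat)
open Summit.QuantumFields.YangMills.BalabanUVNodes.N15.VectorPiece (bshiftEquiv kingPrV kingPrV_bshiftEquiv_pow fibre_conn_kingPrV bshiftEquiv_comm)
open Summit.QuantumFields.YangMills.BalabanUVNodes.N15.MatrixSpecies (mmulOp coordMat basisConst basisConst_nonneg liftBlk liftMap liftEquiv)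
open Summit.QuantumFields.YangMills.BalabanUVNodes.N15.CurvedSpecies (gaugePair expTrField curvCoefC_one curvCoefA_one twoSidedLetters_curvCoef_one_of_meanGauge
  coordMat_adCLM_transpose_eq_neg_of_conjTranspose)

variable {d : ℕ} {L : ℕ} [NeZero L]

set_option maxHeartbeats 800000 in
/-- ★★★ **ENTRY 2 `cvGlued∘∇̂⁻_ν` IN THE GLOBAL SMALL-FIELD GAUGE, ONE GRID** — n15-c∕175 with the species letters of `e^{ηĀ′}`, `Ā′ = gavgM π̂ A′`, produced from the C² window of the
fine potential `A′` (FILE 133's hypotheses verbatim).  MODEL operator ∕ class ∕ pairing ∕ carriers; NOT [B9] Thm 3.1 as printed. [cite: Balaban1985BackgroundPropagators, Thm 3.1 p.397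
((3.42), entry `G∇*`: shape), (3.34)–(3.35) p.396, (3.50)–(3.52) p.400; Balaban1984PropagatorsII, (2.91)–(2.93) p.239, (2.133)–(2.136) p.247; King1986, p.664 (pairing)] -/
theorem sf_bgrad_cvGlued_spec (hL : Odd L ∧ 1 < L) (hL7 : 7 ≤ L) {a : ℝ} (ha : 0 < a) (ι : Type) [Fintype ι] [DecidableEq ι] :
    ∃ δ w₀ R₀ B : ℝ, 0 < δ ∧ 0 < R₀ ∧ 0 < B ∧
      ∀ (mv kk r : ℕ) (ν : Fin (d + 1)), 1 ≤ kk → w₀ ≤ ((L ^ mv : ℕ) : ℝ) →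
      ∀ {mm : Type} [Fintype mm] [DecidableEq mm] (e : Matrix mm mm ℂ ≃L[ℝ] (ι → ℝ)), (∀ A B : Matrix mm mm ℂ, traceForm A B = e A ⬝ᵥ e B) →
      ∀ (A' : Fin (d + 1) → CvX' d L mv kk r hL → Matrix mm mm ℂ), (∀ μ x', (A' μ x')ᴴ = -A' μ x') →
      ∀ (rA : ℝ), 0 ≤ rA → (∀ μ x', ‖A' μ x'‖ ≤ rA) →
        (∀ μ κ x', ‖A' μ (bshiftEquiv (cvM d L mv kk hL) (L ^ r * L ^ kk) κ x') - A' μ x'‖ ≤ rA * ((((L ^ r * L ^ kk : ℕ) : ℝ))⁻¹)) →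
        (∀ μ κ x', ‖(A' μ (bshiftEquiv (cvM d L mv kk hL) (L ^ r * L ^ kk) κ x') - A' μ x') -
            (A' μ (bshiftEquiv (cvM d L mv kk hL) (L ^ r * L ^ kk) κ ((bshiftEquiv (cvM d L mv kk hL) (L ^ r * L ^ kk) μ).symm x')) -
              A' μ ((bshiftEquiv (cvM d L mv kk hL) (L ^ r * L ^ kk) μ).symm x'))‖ ≤ rA * ((((L ^ r * L ^ kk : ℕ) : ℝ))⁻¹) * ((((L ^ r * L ^ kk : ℕ) : ℝ))⁻¹)) →
        2 * ((1 + Fintype.card (Fin (d + 1))) * ((3 + 2 * ((d : ℝ) + 1)) * rA)) ≤ 1 →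
        (14 * Real.exp 1 * (1 + Fintype.card (Fin (d + 1))) * basisConst e * ((1 + Fintype.card (Fin (d + 1))) * ((3 + 2 * ((d : ℝ) + 1)) * rA))) * (1 + Fintype.card (Fin (d + 1) ⊕ Fin (d + 1))) ≤ R₀ →
        HasMaj (CvNorm d L mv kk hL ι) (CvNorm d L mv kk hL ι)
          (cvGlued d L mv kk hL a ((((L ^ kk : ℕ) : ℝ))⁻¹) ι e (fun _ _ => (1 : Matrix mm mm ℂ)) (fun μ x => NormedSpace.exp (((((L ^ kk : ℕ) : ℝ))⁻¹) • gavgM (Matrix mm mm ℂ) (Fin (d + 1)) (kingPrV L kk r (cvM d L mv kk hL)) A' μ x)) (cvNL d L mv kk hL a ι) (fun _ => 0) ∘ₗ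
            bgrad ((((L ^ kk : ℕ) : ℝ))⁻¹)⁻¹ (liftEquiv (bshiftEquiv (cvM d L mv kk hL) (L ^ kk) ν) ι))
          (fun y y' => B * Real.exp (-(δ * (unitTorusGeo L kk (cvM d L mv kk hL)).dist y y'))) := by
  have hLpos : 0 < L := Nat.pos_of_ne_zero (NeZero.ne L)
  obtain ⟨δ₁, w₁, R₁, B₁, hδ₁, hR₁, hB₁, H₁⟩ := one_bgrad_cvGlued_spec (d := d) hL hL7 ha ι
  refine ⟨δ₁ / 16, w₁, R₁, B₁, by positivity, hR₁, hB₁, fun mv kk r ν hk hw₀ => ?_⟩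
  intro mm _ _ e he A' hA' rA hrA h1 h2 h3 hr2 hRle
  -- the two spacings
  have hkpos : (0 : ℝ) < ((L ^ kk : ℕ) : ℝ) := Nat.cast_pos.mpr (pow_pos hLpos kk)
  have hrkpos : (0 : ℝ) < ((L ^ r * L ^ kk : ℕ) : ℝ) := Nat.cast_pos.mpr (Nat.mul_pos (pow_pos hLpos r) (pow_pos hLpos kk))
  have hη : (0 : ℝ) < ((((L ^ kk : ℕ) : ℝ))⁻¹) := inv_pos.mpr hkpos
  have hη' : (0 : ℝ) < ((((L ^ r * L ^ kk : ℕ) : ℝ))⁻¹) := inv_pos.mpr hrkpos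
  have hN : ((((L ^ kk : ℕ) : ℝ))⁻¹) = ((L ^ r : ℕ) : ℝ) * ((((L ^ r * L ^ kk : ℕ) : ℝ))⁻¹) := by
    have hr0 : ((L ^ r : ℕ) : ℝ) ≠ 0 := Nat.cast_ne_zero.mpr (pow_ne_zero _ (NeZero.ne L))
    rw [Nat.cast_mul]; field_simp
  have hη1 : ((((L ^ kk : ℕ) : ℝ))⁻¹) ≤ 1 := inv_le_one_of_one_le₀ (by exact_mod_cast Nat.one_le_pow kk L hLpos)
  have hC₀ : (0 : ℝ) ≤ 2 * ((d : ℝ) + 1) := by positivity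
  have hCθ : ((2 * ((d + 1) * (L ^ r - 1)) : ℕ) : ℝ) * ((((L ^ r * L ^ kk : ℕ) : ℝ))⁻¹) ≤ 2 * ((d : ℝ) + 1) * ((((L ^ kk : ℕ) : ℝ))⁻¹) := by
    have hsub : (((L ^ r - 1 : ℕ)) : ℝ) ≤ ((L ^ r : ℕ) : ℝ) := by exact_mod_cast Nat.sub_le _ _
    have hcast : ((2 * ((d + 1) * (L ^ r - 1)) : ℕ) : ℝ) = 2 * ((d : ℝ) + 1) * (((L ^ r - 1 : ℕ)) : ℝ) := by push_cast; ring
    rw [hcast, hN]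
    calc 2 * ((d : ℝ) + 1) * (((L ^ r - 1 : ℕ)) : ℝ) * ((((L ^ r * L ^ kk : ℕ) : ℝ))⁻¹) ≤ 2 * ((d : ℝ) + 1) * ((L ^ r : ℕ) : ℝ) * ((((L ^ r * L ^ kk : ℕ) : ℝ))⁻¹) :=
          mul_le_mul_of_nonneg_right (mul_le_mul_of_nonneg_left hsub hC₀) hη'.le
      _ = 2 * ((d : ℝ) + 1) * (((L ^ r : ℕ) : ℝ) * ((((L ^ r * L ^ kk : ℕ) : ℝ))⁻¹)) := by ring
  -- King's pairing geometry and skewness in coordinates (as FILE 133)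
  have hcomm := fun μ κ (x : CvX' d L mv kk r hL) => bshiftEquiv_comm (cvM d L mv kk hL) (L ^ r * L ^ kk) μ κ x
  have hconn := fun (f : CvX' d L mv kk r hL → Matrix mm mm ℂ) (β : ℝ)
      (hf : ∀ κ x, ‖f (bshiftEquiv (cvM d L mv kk hL) (L ^ r * L ^ kk) κ x) - f x‖ ≤ β) => fibre_conn_kingPrV L kk r (cvM d L mv kk hL) f β hf
  have hblk := fun μ (x' : CvX' d L mv kk r hL) => kingPrV_bshiftEquiv_pow L kk r (cvM d L mv kk hL) μ x'
  have hAm : ∀ μ x, (gavgM (Matrix mm mm ℂ) (Fin (d + 1)) (kingPrV L kk r (cvM d L mv kk hL)) A' μ x)ᴴ = -gavgM (Matrix mm mm ℂ) (Fin (d + 1)) (kingPrV L kk r (cvM d L mv kk hL)) A' μ x :=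
    gavgM_conjTranspose_of_skew (kingPrV L kk r (cvM d L mv kk hL)) hA'
  have hA'c := fun μ x' => coordMat_adCLM_transpose_eq_neg_of_conjTranspose e he (hA' μ x')
  have hAmc := fun μ x => coordMat_adCLM_transpose_eq_neg_of_conjTranspose e he (hAm μ x)
  obtain ⟨hc, hcA, -, -, -, -, hga, -, hgb, -, -, -, -, -, -⟩ :=
    twoSidedLetters_curvCoef_one_of_meanGauge e (π := (kingPrV L kk r (cvM d L mv kk hL))) (s := bshiftEquiv (cvM d L mv kk hL) (L ^ kk))
      (s' := bshiftEquiv (cvM d L mv kk hL) (L ^ r * L ^ kk)) (N := L ^ r) (θ := ((((L ^ kk : ℕ) : ℝ))⁻¹)) (Cπ := ((2 * ((d + 1) * (L ^ r - 1)) : ℕ) : ℝ)) (C₀ := 2 * ((d : ℝ) + 1))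
      hcomm hconn hblk hη' hN hη hη1 le_rfl hC₀ hCθ hrA hr2 hA'c hAmc h1 h2 h3
  rw [curvCoefC_one, curvCoefA_one, ← conj_one_exp_eq_expTrField e ((((L ^ kk : ℕ) : ℝ))⁻¹) hAm] at hc hcA hga hgb
  have hκ0 : 0 ≤ basisConst e := basisConst_nonneg e
  have hS0 : 0 ≤ (14 * Real.exp 1 * (1 + Fintype.card (Fin (d + 1))) * basisConst e * ((1 + Fintype.card (Fin (d + 1))) * ((3 + 2 * ((d : ℝ) + 1)) * rA))) := by positivity
  have hR₁le : (14 * Real.exp 1 * (1 + Fintype.card (Fin (d + 1))) * basisConst e * ((1 + Fintype.card (Fin (d + 1))) * ((3 + 2 * ((d : ℝ) + 1)) * rA))) ≤ R₁ := by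
    have hJJ : (1 : ℝ) ≤ 1 + Fintype.card (Fin (d + 1) ⊕ Fin (d + 1)) := by
      have : (0 : ℝ) ≤ Fintype.card (Fin (d + 1) ⊕ Fin (d + 1)) := by positivity
      linarith
    exact (le_mul_of_one_le_right hS0 hJJ).trans hRle
  have key := H₁ mv kk ν hk hw₀ e he (fun μ x => NormedSpace.exp (((((L ^ kk : ℕ) : ℝ))⁻¹) • gavgM (Matrix mm mm ℂ) (Fin (d + 1)) (kingPrV L kk r (cvM d L mv kk hL)) A' μ x))
    (14 * Real.exp 1 * (1 + Fintype.card (Fin (d + 1))) * basisConst e * ((1 + Fintype.card (Fin (d + 1))) * ((3 + 2 * ((d : ℝ) + 1)) * rA))) hS0 hR₁le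
    hc hcA (fun μ x i => hga μ x i) (fun μ x i => hgb μ x i)
  exact key

end Summit.QuantumFields.YangMills.BalabanUVNodes.N15.Gluing

end
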